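import Summits.AtomisticToContinuum.Crystallization.Theorems.PalmUnimodularRigidityLayeredLawsSelectHcpLocalCongruence

/-!
# Crux `LayeredLawsSelectHcp` (stmt-AtomisticToContinuum-9226), line `mtp-prestress-split-ergodic-frame`:
# rooted labelled charts of an hcp-charted configuration

Registered sub-goal `tube_exists_rootedChart` of the crux item (lead c2, cycle 3; block R3-A of the certificate architecture
`Cruxes/LayeredLawsSelectHcp/LeadC2Architecture.md`).  The directed orbit-sum CORRECTORS of the rigidity certificate are sums over
the ROOTED LABELLED CHARTS of the sample: maps `X : ℤ³ → S` with `X 0 = 0` (the root), onto `S`, under which the ideal unit struts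
(`dist (Pᵢ u) (Pᵢ w) = 1`, `Pᵢ = hcpSite 1 √(2/3)`) are exactly the bonds of `S` (`0 < dist ≤ 28/25`).  This file records that such a
chart EXISTS for every hcp-charted `S ∋ 0` (the `HcpCharted` bijection re-rooted at the label of `0` by the homogeneity of the ideal
hcp, `hcpStacking_homogeneous` — the opening move of the landed `stub_localCongruence`, extracted for reuse), that rooted charts are
injective, and that under a rooted chart the labelled twelve-point star of any label `v` is the full bond-neighbourhood of `X v` in `S`.
[folklore]
-/

noncomputable section

namespace Summit.AtomisticToContinuum.Crystallization.Theorems.PalmUnimodularRigidity.LayeredLawsSelectHcp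

open MeasureTheory Set
open Literature.MathematicalPhysics.StatisticalMechanics Literature.Geometry.DiscreteGeometry

/-- **Registered sub-goal `tube_exists_rootedChart` — rooted labelled charts exist.**  For an hcp-charted `S` containing the origin
there is `X : ℤ³ → ℝ³` with `X 0 = 0`, values in `S`, onto `S`, and `dist (Pᵢ u) (Pᵢ w) = 1 ↔ (0 < dist (X u) (X w) ∧
dist (X u) (X w) ≤ 28/25)` for all labels `u, w` (`Pᵢ = hcpSite 1 √(2/3)`). [folklore] -/
theorem tube_exists_rootedChart :
    ∀ S : Set (EuclideanSpace ℝ (Fin 3)), (0 : EuclideanSpace ℝ (Fin 3)) ∈ S → HcpCharted S →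
      ∃ X : ℤ × ℤ × ℤ → EuclideanSpace ℝ (Fin 3), X 0 = 0 ∧ (∀ u, X u ∈ S) ∧ (∀ y ∈ S, ∃ u, X u = y) ∧
        ∀ u w, dist (hcpSite 1 (Real.sqrt (2 / 3)) u) (hcpSite 1 (Real.sqrt (2 / 3)) w) = 1 ↔
          (0 < dist (X u) (X w) ∧ dist (X u) (X w) ≤ 28 / 25) := by
  intro S h0 hchart
  obtain ⟨Φ, hbij, hbond⟩ := hchart
  obtain ⟨p₀, hp₀, hΦp₀⟩ := hbij.surjOn h0
  obtain ⟨B, hB⟩ := hcpStacking_homogeneous 1 (Real.sqrt (2 / 3)) hp₀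
  set X : ℤ × ℤ × ℤ → EuclideanSpace ℝ (Fin 3) := fun u => Φ (p₀ + B (hcpSite 1 (Real.sqrt (2 / 3)) u)) with hX
  have hPmem : ∀ u, hcpSite 1 (Real.sqrt (2 / 3)) u ∈ hcpStacking 1 (Real.sqrt (2 / 3)) :=
    fun u => barlowPos_mem _ _ _
  have hmem : ∀ u, p₀ + B (hcpSite 1 (Real.sqrt (2 / 3)) u) ∈ hcpStacking 1 (Real.sqrt (2 / 3)) :=
    fun u => (hB _).1 (hPmem u)
  refine ⟨X, ?_, fun u => hbij.mapsTo (hmem u), ?_, ?_⟩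
  · change Φ (p₀ + B (hcpSite 1 (Real.sqrt (2 / 3)) 0)) = 0
    rw [hcpSite_zero, map_zero, add_zero, hΦp₀]
  · intro y hy
    obtain ⟨p, hp, rfl⟩ := hbij.surjOn hy
    have hq : p₀ + B (B.symm (p - p₀)) = p := by simp
    have hqmem : B.symm (p - p₀) ∈ hcpStacking 1 (Real.sqrt (2 / 3)) := (hB _).2 (by rw [hq]; exact hp)
    obtain ⟨k, i, j, hqe⟩ := hqmem
    refine ⟨(k, i, j), ?_⟩
    change Φ (p₀ + B (barlowPos 1 (Real.sqrt (2 / 3)) alternatingHagg k i j)) = Φ p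
    rw [← hqe, hq]
  · intro u w
    rw [← hbond _ (hmem u) _ (hmem w), dist_add_left, LinearIsometryEquiv.dist_map]

/-- Under a labelled chart, labels at ideal distance `1` have distinct images (the bond clause gives `0 < dist`). [folklore] -/
theorem rootedChart_ne_of_dist_eq_one {X : ℤ × ℤ × ℤ → EuclideanSpace ℝ (Fin 3)}
    (hX : ∀ u w, dist (hcpSite 1 (Real.sqrt (2 / 3)) u) (hcpSite 1 (Real.sqrt (2 / 3)) w) = 1 ↔
      (0 < dist (X u) (X w) ∧ dist (X u) (X w) ≤ 28 / 25))
    {u w : ℤ × ℤ × ℤ} (h : dist (hcpSite 1 (Real.sqrt (2 / 3)) u) (hcpSite 1 (Real.sqrt (2 / 3)) w) = 1) :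
    X u ≠ X w := by
  intro heq
  have := ((hX u w).1 h).1
  rw [heq, dist_self] at this
  exact lt_irrefl _ this

/-- **Under a rooted chart the bond-neighbourhood of `X v` in `S` is the labelled image of the ideal unit-strut neighbours of `v`**:
`{y ∈ S | 0 < dist y (X v) ≤ 28/25} = X '' {w | dist (Pᵢ v) (Pᵢ w) = 1}`. [folklore] -/
theorem rootedChart_bondNbhd_eq {S : Set (EuclideanSpace ℝ (Fin 3))} {X : ℤ × ℤ × ℤ → EuclideanSpace ℝ (Fin 3)}
    (hXS : ∀ u, X u ∈ S) (hSX : ∀ y ∈ S, ∃ u, X u = y)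
    (hX : ∀ u w, dist (hcpSite 1 (Real.sqrt (2 / 3)) u) (hcpSite 1 (Real.sqrt (2 / 3)) w) = 1 ↔
      (0 < dist (X u) (X w) ∧ dist (X u) (X w) ≤ 28 / 25)) (v : ℤ × ℤ × ℤ) :
    {y : EuclideanSpace ℝ (Fin 3) | y ∈ S ∧ 0 < dist y (X v) ∧ dist y (X v) ≤ 28 / 25} =
      X '' {w : ℤ × ℤ × ℤ | dist (hcpSite 1 (Real.sqrt (2 / 3)) v) (hcpSite 1 (Real.sqrt (2 / 3)) w) = 1} := by
  ext y
  simp only [Set.mem_setOf_eq, Set.mem_image]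
  constructor
  · rintro ⟨hy, hpos, hle⟩
    obtain ⟨w, rfl⟩ := hSX y hy
    refine ⟨w, (hX v w).2 ⟨?_, ?_⟩, rfl⟩
    · rwa [dist_comm]
    · rwa [dist_comm]
  · rintro ⟨w, hw, rfl⟩
    have h := (hX v w).1 hw
    exact ⟨hXS w, by rw [dist_comm]; exact h.1, by rw [dist_comm]; exact h.2⟩

end Summit.AtomisticToContinuum.Crystallization.Theorems.PalmUnimodularRigidity.LayeredLawsSelectHcp

end
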